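import Summits.Langlands.Langlands.Theses.ParityBlindBianchi
import Literature.NumberTheory.GaloisRepresentations.PolarizedDeformationRing
import Literature.NumberTheory.GaloisRepresentations.PadicPointsOfCompleteLocalRings
import Summits.Langlands.Langlands.Theorems.ParityBlindBianchiTwoAdicBianchiProModularityLevelSqueezeDefs
import Summits.Langlands.Langlands.Theorems.ParityBlindBianchiTwoAdicBianchiProModularityLevelSqueezeDefsLoci
import HarnessLib

/-!
# Line `dimension-squeeze` (crux `TwoAdicBianchiProModularityLevel`, stmt-Langlands-15110): AUT from a
# torsion-free Hecke algebra of dimension `≥ 4` — generic form (any ideal `I`)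

The registered sub-goals `squeeze_heckeDimensionOf_of_denseQuotient` and `squeeze_heckeDimensionOf_of_heckeAlgebra`
(lead c14): the two formal lemmas of the automorphic stub `stub_heckeDimension` (AUT) of the checked skeleton
`Cruxes/TwoAdicBianchiProModularityLevel/Lines/dimension_squeeze.lean`, stated for the Hecke points of `V(I)` for an
ARBITRARY ideal `I` of the universal ring (v3 vocabulary `heckePointsOf` / `heckeIdealOf` of the landed
`…SqueezeDefsLoci.lean`; the v3 stub is the case `I = typeIdealD`, the v2 statements the case `I = typeIdeal`):
(1) `dim (R ⧸ heckeIdealOf I U) ≥ 4` follows from a surjection `q : R ↠ T` onto a ring of Krull dimension `≥ 4` whose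
`𝒪_{ℚ̄₂}`-points that are Hecke points of `V(I)` separate the elements of `T`; (2) by the DENSITY theorem
(`Literature…exists_ringHom_padicAlgCl_apply_ne_zero`) it suffices that `T` be reduced, `𝒪`-torsion-free, complete
Noetherian local, `q` an `𝒪`-algebra map, and every `𝒪`-algebra point `ψ : T → 𝒪_{ℚ̄₂}` give a Hecke point `ψ ∘ q`
of `V(I)`.  With `T` the reduced `I`-typed quotient of the big Hecke algebra `𝕋(U²)_𝔪` this isolates the remaining
inputs of AUT: SURJ (`R ↠ 𝕋_𝔪`, Scholze + Chenevier + Carayol), TF (`2`-torsion-freeness ⇐ Gee–Newton (c)-lite, OPEN)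
and DIM (`dim ≥ 4` ⇐ Gee–Newton Prop. 54 + (c) + App. §6.3, OPEN).

Reference: T. Gee, J. Newton, *Patching and the completed homology of locally symmetric spaces*,
JIMJ (2022) / arXiv:1609.06965, Prop. 54, Rem. 55, Prop. 57, Rem. 58. [cite: GeeNewton2020, Prop. 54 and Rem. 58]
-/


noncomputable section

set_option linter.dupNamespace false -- `Summit.Langlands.Langlands` is the mandated namespace (D-0017)

open scoped NumberField MatrixGroups
open Polynomial IsDedekindDomain Field IsLocalRing
open Literature.NumberTheory.GaloisRepresentations Literature.NumberTheory.Automorphic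

namespace Summit.Langlands.Langlands.Cruxes.TwoAdicBianchiProModularityLevel.DimensionSqueeze

/-- Membership in `𝒪_{ℚ̄₂}` is the norm bound `‖x‖ ≤ 1`. [folklore] -/
theorem mem_O2_iff_norm_le_one (x : PadicAlgCl 2) :
    x ∈ (PadicAlgCl.valued 2).v.valuationSubring ↔ ‖x‖ ≤ 1 := by
  rw [Valuation.mem_valuationSubring_iff, PadicAlgCl.valuation_def, ← NNReal.coe_le_coe,
    coe_nnnorm, NNReal.coe_one]

/-- The structure map of an `𝒪`-algebra quotient `q : R ↠ T` of the universal ring is local on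
`𝒪` and has the residue field of `𝒪`: `𝔪_𝒪 T ⊆ 𝔪_T` and `𝒪 → T/𝔪_T` is onto (the kernel of
`𝒪 ↠ k` is `𝔪_𝒪`, the augmentation of `R` is `𝒪`-linear with kernel `𝔪_R`, and a surjection of
local rings is local). [folklore] -/
theorem map_maximalIdeal_le_and_residue_surjective {K : Type} [Field K] [NumberField K]
    {σ : FramedGaloisRep K (PadicAlgCl 2) 2} (M : Model σ) {S₀ : Finset ℕ} {h0 : (0 : ℕ) ∉ S₀}
    {h2 : 2 ∈ S₀} {hunr : ∀ v ∉ badSet K S₀, Deformation.IsUnramifiedAt v M.residual}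
    (𝓡 : PolarizedDeformationRing (M.datum S₀ h0 h2 hunr))
    (T : Type) [CommRing T] [IsLocalRing T] [Algebra M.𝒪 T] (q : 𝓡.R →ₐ[M.𝒪] T)
    (hq : Function.Surjective q) :
    (maximalIdeal M.𝒪).map (algebraMap M.𝒪 T) ≤ maximalIdeal T ∧
      Function.Surjective ((residue T).comp (algebraMap M.𝒪 T)) := by
  haveI := IsLocalHom.of_surjective (q : 𝓡.R →+* T) hq
  -- `ker (𝒪 → k) = 𝔪_𝒪`
  have hker : RingHom.ker (algebraMap M.𝒪 M.k) = maximalIdeal M.𝒪 :=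
    IsLocalRing.eq_maximalIdeal (RingHom.ker_isMaximal_of_surjective _ M.residue_surjective)
  -- `𝒪 → R` maps `𝔪_𝒪` into `𝔪_R = ker π`
  have hOR : ∀ a ∈ maximalIdeal M.𝒪, algebraMap M.𝒪 𝓡.R a ∈ maximalIdeal 𝓡.R := by
    intro a ha
    rw [← 𝓡.ker_π, RingHom.mem_ker, RingHom.coe_coe, AlgHom.commutes, ← RingHom.mem_ker, hker]
    exact ha
  -- `q` maps `𝔪_R` into `𝔪_T`
  have hRT : ∀ r ∈ maximalIdeal 𝓡.R, q r ∈ maximalIdeal T := by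
    intro r hr
    rw [mem_maximalIdeal] at hr ⊢
    exact fun hu => hr (IsLocalHom.map_nonunit (f := (q : 𝓡.R →+* T)) r hu)
  have hqalg : ∀ a, algebraMap M.𝒪 T a = q (algebraMap M.𝒪 𝓡.R a) := fun a => (q.commutes a).symm
  refine ⟨?_, ?_⟩
  · rw [Ideal.map_le_iff_le_comap]
    intro a ha
    rw [Ideal.mem_comap, hqalg]
    exact hRT _ (hOR a ha)
  · intro y
    obtain ⟨t, rfl⟩ := IsLocalRing.residue_surjective y
    obtain ⟨r, rfl⟩ := hq t
    obtain ⟨a, ha⟩ := M.residue_surjective (𝓡.π r)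
    refine ⟨a, ?_⟩
    change IsLocalRing.residue T (algebraMap M.𝒪 T a) = IsLocalRing.residue T (q r)
    rw [hqalg]
    change Ideal.Quotient.mk (maximalIdeal T) _ = Ideal.Quotient.mk (maximalIdeal T) _
    rw [Ideal.Quotient.eq, ← map_sub]
    refine hRT _ ?_
    rw [← 𝓡.ker_π, RingHom.mem_ker, RingHom.coe_coe, map_sub, AlgHom.commutes, ha, sub_self]

/-- REGISTERED SUB-GOAL `squeeze_heckeDimensionOf_of_denseQuotient` (lead c14; AUT, first lemma, generic
form).  **`dim (R ⧸ heckeIdealOf I U) ≥ 4` follows from a Hecke quotient with Zariski-dense Hecke points and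
Krull dimension `≥ 4`.** [cite: GeeNewton2020, Prop. 54 and Rem. 58] -/
theorem squeeze_heckeDimensionOf_of_denseQuotient : ∀ (K : Type) [Field K] [NumberField K]
    (σ : FramedGaloisRep K (PadicAlgCl 2) 2) (M : Model σ) (S₀ : Finset ℕ) (h0 : (0 : ℕ) ∉ S₀) (h2 : 2 ∈ S₀)
    (hunr : ∀ v ∉ badSet K S₀, Deformation.IsUnramifiedAt v M.residual)
    (𝓡 : PolarizedDeformationRing (M.datum S₀ h0 h2 hunr)) (I : Ideal 𝓡.R)
    (U : Subgroup (GL (Fin 2) (FiniteAdeleRing (𝓞 K) K)))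
    (ϖ : ∀ v : HeightOneSpectrum (𝓞 K), (v.adicCompletion K)ˣ)
    (T : Type) [CommRing T] (q : 𝓡.R →+* T), Function.Surjective q →
    (∀ x : 𝓡.R, (∀ ψ : T →+* O2, ψ.comp q ∈ M.heckePointsOf 𝓡 I U ϖ → ψ (q x) = 0) → q x = 0) →
    (4 : WithBot ℕ∞) ≤ ringKrullDim T →
    (4 : WithBot ℕ∞) ≤ ringKrullDim (𝓡.R ⧸ M.heckeIdealOf 𝓡 I U ϖ) := by
  intro K _ _ σ M S₀ h0 h2 hunr 𝓡 I U ϖ T _ q hq hdense hdim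
  have hle : M.heckeIdealOf 𝓡 I U ϖ ≤ RingHom.ker q := by
    intro x hx
    rw [RingHom.mem_ker]
    refine hdense x fun ψ hψ => ?_
    have hx' : x ∈ RingHom.ker (ψ.comp q) := by
      have := (Submodule.mem_iInf _).mp hx (ψ.comp q)
      exact (Submodule.mem_iInf _).mp this hψ
    simpa [RingHom.mem_ker] using hx'
  have hsurj : Function.Surjective ((RingHom.quotientKerEquivOfSurjective hq).toRingHom.comp
      (Ideal.Quotient.factor hle)) :=
    (RingHom.quotientKerEquivOfSurjective hq).surjective.comp (Ideal.Quotient.factor_surjective hle)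
  exact hdim.trans (ringKrullDim_le_of_surjective _ hsurj)

/-- REGISTERED SUB-GOAL `squeeze_heckeDimensionOf_of_heckeAlgebra` (lead c14; AUT, second lemma, generic form).
**`dim (R ⧸ heckeIdealOf I U) ≥ 4` follows from a reduced, `𝒪`-torsion-free, complete local Hecke quotient
`q : R ↠ T` of dimension `≥ 4` all of whose `𝒪_{ℚ̄₂}`-valued `𝒪`-algebra points give Hecke points of `V(I)`**
(DENSITY + the first lemma). [cite: GeeNewton2020, Prop. 54 and Rem. 58] -/
theorem squeeze_heckeDimensionOf_of_heckeAlgebra : ∀ (K : Type) [Field K] [NumberField K]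
    (σ : FramedGaloisRep K (PadicAlgCl 2) 2) (M : Model σ) (S₀ : Finset ℕ) (h0 : (0 : ℕ) ∉ S₀) (h2 : 2 ∈ S₀)
    (hunr : ∀ v ∉ badSet K S₀, Deformation.IsUnramifiedAt v M.residual)
    (𝓡 : PolarizedDeformationRing (M.datum S₀ h0 h2 hunr)) (I : Ideal 𝓡.R)
    (U : Subgroup (GL (Fin 2) (FiniteAdeleRing (𝓞 K) K)))
    (ϖ : ∀ v : HeightOneSpectrum (𝓞 K), (v.adicCompletion K)ˣ)
    (T : Type) [CommRing T] [IsLocalRing T] [IsNoetherianRing T]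
    [IsAdicComplete (maximalIdeal T) T] [IsReduced T] [Algebra M.𝒪 T] (q : 𝓡.R →ₐ[M.𝒪] T),
    Function.Surjective q →
    (∀ a : M.𝒪, a ≠ 0 → algebraMap M.𝒪 T a ∈ nonZeroDivisors T) →
    (∀ ψ : T →+* O2, ψ.comp (algebraMap M.𝒪 T) = M.emb →
      ψ.comp (q : 𝓡.R →+* T) ∈ M.heckePointsOf 𝓡 I U ϖ) →
    (4 : WithBot ℕ∞) ≤ ringKrullDim T →
    (4 : WithBot ℕ∞) ≤ ringKrullDim (𝓡.R ⧸ M.heckeIdealOf 𝓡 I U ϖ) := by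
  intro K _ _ σ M S₀ h0 h2 hunr 𝓡 I U ϖ T _ _ _ _ _ _ q hq htf hHecke hdim
  obtain ⟨hloc, hres⟩ := map_maximalIdeal_le_and_residue_surjective M 𝓡 T q hq
  refine squeeze_heckeDimensionOf_of_denseQuotient K σ M S₀ h0 h2 hunr 𝓡 I U ϖ T (q : 𝓡.R →+* T) hq
    ?_ hdim
  intro x hx
  by_contra hne
  have hnil : ¬ IsNilpotent (q x) := fun h => hne h.eq_zero
  let ι : M.𝒪 →+* PadicAlgCl 2 := O2.incl.comp M.emb
  have hι : Function.Injective ι := Subtype.val_injective.comp M.emb_injective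
  have hιn : ∀ a, ‖ι a‖ ≤ 1 := fun a => (mem_O2_iff_norm_le_one _).mp (M.emb a).2
  obtain ⟨ψ₀, hψ₀, hψ₀n, hψ₀x⟩ :=
    exists_ringHom_padicAlgCl_apply_ne_zero ι hι hιn T htf hloc hres hnil
  let ψ : T →+* O2 := ψ₀.codRestrict (PadicAlgCl.valued 2).v.valuationSubring.toSubring fun t =>
    (mem_O2_iff_norm_le_one _).mpr (hψ₀n t)
  have hψ : ψ.comp (algebraMap M.𝒪 T) = M.emb := by
    refine RingHom.ext fun a => Subtype.ext ?_
    change ψ₀ (algebraMap M.𝒪 T a) = O2.incl (M.emb a)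
    exact DFunLike.congr_fun hψ₀ a
  have h0 : ψ (q x) = 0 := hx ψ (hHecke ψ hψ)
  exact hψ₀x (by simpa [ψ] using congrArg Subtype.val h0)

/-- REGISTERED SUB-GOAL `squeeze_heckeDimension_of_heckeAlgebra` (lead c14; the v2 instance `I = typeIdeal`,
registered before the v3 reshape; kept as the specialisation of the generic lemma).
[cite: GeeNewton2020, Prop. 54 and Rem. 58] -/
theorem squeeze_heckeDimension_of_heckeAlgebra : ∀ (K : Type) [Field K] [NumberField K]
    (σ : FramedGaloisRep K (PadicAlgCl 2) 2) (M : Model σ) (S₀ : Finset ℕ) (h0 : (0 : ℕ) ∉ S₀) (h2 : 2 ∈ S₀)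
    (hunr : ∀ v ∉ badSet K S₀, Deformation.IsUnramifiedAt v M.residual)
    (𝓡 : PolarizedDeformationRing (M.datum S₀ h0 h2 hunr))
    (U : Subgroup (GL (Fin 2) (FiniteAdeleRing (𝓞 K) K)))
    (ϖ : ∀ v : HeightOneSpectrum (𝓞 K), (v.adicCompletion K)ˣ)
    (T : Type) [CommRing T] [IsLocalRing T] [IsNoetherianRing T]
    [IsAdicComplete (maximalIdeal T) T] [IsReduced T] [Algebra M.𝒪 T] (q : 𝓡.R →ₐ[M.𝒪] T),
    Function.Surjective q →
    (∀ a : M.𝒪, a ≠ 0 → algebraMap M.𝒪 T a ∈ nonZeroDivisors T) →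
    (∀ ψ : T →+* O2, ψ.comp (algebraMap M.𝒪 T) = M.emb →
      ψ.comp (q : 𝓡.R →+* T) ∈ M.heckePoints 𝓡 U ϖ) →
    (4 : WithBot ℕ∞) ≤ ringKrullDim T →
    (4 : WithBot ℕ∞) ≤ ringKrullDim (𝓡.R ⧸ M.heckeIdeal 𝓡 U ϖ) :=
  fun K _ _ σ M S₀ h0 h2 hunr 𝓡 U ϖ T _ _ _ _ _ _ q hq htf hHecke hdim =>
    squeeze_heckeDimensionOf_of_heckeAlgebra K σ M S₀ h0 h2 hunr 𝓡 (M.typeIdeal 𝓡) U ϖ T q hq htf hHecke hdim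

end Summit.Langlands.Langlands.Cruxes.TwoAdicBianchiProModularityLevel.DimensionSqueeze

end
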